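import Summits.Ventures.PercRepro.RankLevelSetLevelSixHeavyCellSq31F

/-!
# PercRepro — THE LEVEL-BY-LEVEL TAIL: THE SETS OF RANK `≤ 5` OF THE `e`-FREE CORE (p8 g5, S3)

`proofs/SUBCLAIM-S3-p8.md` §3r. Every tail form of the level-`6` cell theorems bounds the sets of rank `≤ 5` by ALL the
sets of at most `min 19 (5 + d)` elements — `Σ_{j ≤ min 19 (5 + d)} C(n, j)`, which is `2.35 %` of `2^n` at the cell
`(30, 7)` and `22.6 %` at `(30, 14)`: the whole `K_d/K_n` loss of the rows. Here the same sets are counted LEVEL BY LEVEL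
with the heavy / light count itself (`ncard_eRk_eq_ncard_le_le_heavy_fifteen_cap`, generic in `q`): at level `q ∈ {3, 4, 5}`
the threshold `ν₁` is taken so large that no rank-`q` set is heavy (`q + ν₁` exceeds the flat bound `f(3) ≤ 6`,
`f(4) ≤ 10`, `f(5) ≤ 19`), the pairs are counted by the disjoint pair count, and the sets of rank `≤ 2` have at most
`3` elements. The whole rank-`≤ 5` count is then `≈ 0.004 %` of `2^n` at `(30, 7)`. No new matroid input.

* `ncard_eRk_eq_le_level` — one level `q`: `#{r = q} ≤ C(n, q) + (σ(min(f′ − q, ν₁ − 2)) + σ(ν₁ − 2))·P_q(n)` when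
  rank-`q` sets have `≤ cap < q + ν₁` elements;
* **`ncard_eRk_le_five_le_levels`** — `#{r ≤ 5} ≤ Σ_{j ≤ 3} C(n, j) + U₃ + U₄ + U₅` with the circuit bounds
  `s₃ ≤ c3`, `s₄ ≤ c4` as hypotheses and `s₅ ≤ C(d + 4, 5)`, `s₆ ≤ C(d + 5, 6)`.
Axioms: standard.
-/

open scoped Matroid

namespace PercRepro

namespace ThmN

open Set

variable {α : Type}

/-- `Σ_{k = 3}^{4} g k = g 3 + g 4`. -/
theorem sum_Icc_three_four_q_levels (g : ℕ → ℚ) : ∑ k ∈ Finset.Icc 3 4, g k = g 3 + g 4 := by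
  have : Finset.Icc 3 4 = {3, 4} := by decide
  rw [this, Finset.sum_insert (by decide), Finset.sum_singleton]

/-- `Σ_{k = 3}^{5} g k = g 3 + g 4 + g 5`. -/
theorem sum_Icc_three_five_q_levels (g : ℕ → ℚ) : ∑ k ∈ Finset.Icc 3 5, g k = g 3 + g 4 + g 5 := by
  have : Finset.Icc 3 5 = {3, 4, 5} := by decide
  rw [this, Finset.sum_insert (by decide), Finset.sum_insert (by decide), Finset.sum_singleton]
  ring

/-- `Σ_{k = 3}^{6} g k = g 3 + g 4 + g 5 + g 6`. -/
theorem sum_Icc_three_six_q_levels (g : ℕ → ℚ) : ∑ k ∈ Finset.Icc 3 6, g k = g 3 + g 4 + g 5 + g 6 := by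
  have : Finset.Icc 3 6 = {3, 4, 5, 6} := by decide
  rw [this, Finset.sum_insert (by decide), Finset.sum_insert (by decide), Finset.sum_insert (by decide),
    Finset.sum_singleton]
  ring

/-- **One level of the tail.** If every rank-`≤ q` set has at most `cap < q + ν₁` elements, the sets of rank exactly `q`
number at most `C(n, q) + (σ(min(f′ − q, ν₁ − 2)) + σ(ν₁ − 2))·Σ_{k = 3}^{q+1} s_k·C(n − k, q + 1 − k)`,
`σ(a) = Σ_{j ≤ cap − q − 1} C(a, j)·2/mult15(j + 1)`: no rank-`q` set is heavy, and both pair classes are bounded by the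
disjoint pair count. -/
theorem ncard_eRk_eq_le_level (M : Matroid α) [M.Finite] (q f' ν₁ cap : ℕ) (hq : 1 ≤ q)
    (hcirc : ∀ C, M.IsCircuit C → 3 ≤ C.encard) (hline : ∀ L ⊆ M.E, M.eRk L = 2 → L.ncard ≤ 3)
    (hcap : ∀ X ⊆ M.E, M.eRk X ≤ (q : ℕ∞) → X.ncard ≤ cap) (hν : cap < q + ν₁) :
    ({X : Set α | X ⊆ M.E ∧ M.eRk X = (q : ℕ∞)}.ncard : ℚ) ≤ (M.E.ncard.choose q : ℚ) +
      ((∑ j ∈ Finset.range (cap - (q + 1) + 1),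
          ((min (f' - q) (ν₁ - 2)).choose j : ℚ) * (2 / ((Matroid.mult15 (j + 1) : ℕ) : ℚ))) +
        (∑ j ∈ Finset.range (cap - (q + 1) + 1),
          ((ν₁ - 2).choose j : ℚ) * (2 / ((Matroid.mult15 (j + 1) : ℕ) : ℚ)))) *
      (∑ k ∈ Finset.Icc 3 (q + 1),
        ({C | M.IsCircuit C ∧ C.ncard = k}.ncard : ℚ) * (((M.E.ncard - k).choose (q + 1 - k) : ℕ) : ℚ)) := by
  classical
  have hsub : {X : Set α | X ⊆ M.E ∧ M.eRk X = (q : ℕ∞)} ⊆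
      {B : Set α | B ⊆ M.E ∧ M.eRk B = q ∧ B.ncard ≤ cap} :=
    fun X hX => ⟨hX.1, hX.2, hcap X hX.1 hX.2.le⟩
  have h0 : ({X : Set α | X ⊆ M.E ∧ M.eRk X = (q : ℕ∞)}.ncard : ℚ) ≤
      ({B : Set α | B ⊆ M.E ∧ M.eRk B = q ∧ B.ncard ≤ cap}.ncard : ℚ) := by
    exact_mod_cast ncard_le_ncard hsub (M.ground_finite.finite_subsets.subset (fun B hB => hB.1))
  have hG := Matroid.ncard_eRk_eq_ncard_le_le_heavy_fifteen_cap M q f' ν₁ hq hcirc hline cap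
  -- no rank-`q` set is heavy: its closure has at most `cap < q + ν₁` elements
  have hHv : ({B : Set α | B ⊆ M.E ∧ M.eRk B = (q : ℕ∞) ∧ q + ν₁ ≤ (M.closure B).ncard ∧ B.ncard ≤ cap}.ncard : ℚ)
      ≤ 0 := by
    have hempty : {B : Set α | B ⊆ M.E ∧ M.eRk B = (q : ℕ∞) ∧ q + ν₁ ≤ (M.closure B).ncard ∧ B.ncard ≤ cap} = ∅ := by
      ext B
      simp only [Set.mem_setOf_eq, Set.mem_empty_iff_false, iff_false]
      rintro ⟨hB, hr, hcl, -⟩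
      have := hcap _ (M.closure_subset_ground B) (by rw [M.eRk_closure_eq]; exact hr.le)
      omega
    rw [hempty, Set.ncard_empty]
    simp
  -- both pair classes: the disjoint pair count
  have hP : ((Matroid.pairsF M q).card : ℚ) ≤ ∑ k ∈ Finset.Icc 3 (q + 1),
      ({C | M.IsCircuit C ∧ C.ncard = k}.ncard : ℚ) * (((M.E.ncard - k).choose (q + 1 - k) : ℕ) : ℚ) := by
    have h1 := Matroid.card_pairsF_le_disj (M := M) q
    have : (((Matroid.pairsF M q).card : ℕ) : ℚ) ≤
        ((∑ k ∈ Finset.Icc 3 (q + 1),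
          {C | M.IsCircuit C ∧ C.ncard = k}.ncard * (M.E.ncard - k).choose (q + 1 - k) : ℕ) : ℚ) := by
      exact_mod_cast h1
    push_cast at this
    exact this
  have hPs : (((Matroid.pairsLight M q ν₁).filter (fun p => p ∈ Matroid.pairsSmall M q f')).card : ℚ) ≤
      ∑ k ∈ Finset.Icc 3 (q + 1),
        ({C | M.IsCircuit C ∧ C.ncard = k}.ncard : ℚ) * (((M.E.ncard - k).choose (q + 1 - k) : ℕ) : ℚ) := by
    have h1 := Matroid.card_pairsLightSmall_le (M := M) q f' ν₁
    have h2 : (((Matroid.pairsLight M q ν₁).filter (fun p => p ∈ Matroid.pairsSmall M q f')).card : ℚ) ≤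
        ((Matroid.pairsF M q).card : ℚ) := by exact_mod_cast h1
    exact h2.trans hP
  have hPb : (((Matroid.pairsLight M q ν₁).filter (fun p => p ∉ Matroid.pairsSmall M q f')).card : ℚ) ≤
      ∑ k ∈ Finset.Icc 3 (q + 1),
        ({C | M.IsCircuit C ∧ C.ncard = k}.ncard : ℚ) * (((M.E.ncard - k).choose (q + 1 - k) : ℕ) : ℚ) := by
    have h1 := Matroid.card_pairsBigLight_le (M := M) q f' ν₁
    have h2 : (((Matroid.pairsLight M q ν₁).filter (fun p => p ∉ Matroid.pairsSmall M q f')).card : ℚ) ≤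
        ((Matroid.pairsF M q).card : ℚ) := by exact_mod_cast h1
    exact h2.trans hP
  refine h0.trans (hG.trans ?_)
  have hσ1 : (0 : ℚ) ≤ ∑ j ∈ Finset.range (cap - (q + 1) + 1),
      ((min (f' - q) (ν₁ - 2)).choose j : ℚ) * (2 / ((Matroid.mult15 (j + 1) : ℕ) : ℚ)) :=
    Finset.sum_nonneg (fun i _ => by positivity)
  have hσ2 : (0 : ℚ) ≤ ∑ j ∈ Finset.range (cap - (q + 1) + 1),
      ((ν₁ - 2).choose j : ℚ) * (2 / ((Matroid.mult15 (j + 1) : ℕ) : ℚ)) :=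
    Finset.sum_nonneg (fun i _ => by positivity)
  have e1 := mul_le_mul_of_nonneg_left hPs hσ1
  have e2 := mul_le_mul_of_nonneg_left hPb hσ2
  have h3 := add_le_add (add_le_add (add_le_add (le_refl ((M.E.ncard.choose q : ℕ) : ℚ)) e1) e2) hHv
  refine h3.trans (le_of_eq ?_)
  ring

/-- The sets of rank `≤ q + 1` split into those of rank `≤ q` and those of rank exactly `q + 1`. -/
theorem ncard_eRk_le_succ_le (M : Matroid α) [M.Finite] (q : ℕ) :
    {X : Set α | X ⊆ M.E ∧ M.eRk X ≤ ((q + 1 : ℕ) : ℕ∞)}.ncard ≤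
      {X : Set α | X ⊆ M.E ∧ M.eRk X ≤ (q : ℕ∞)}.ncard +
        {X : Set α | X ⊆ M.E ∧ M.eRk X = ((q + 1 : ℕ) : ℕ∞)}.ncard := by
  classical
  have hsub : {X : Set α | X ⊆ M.E ∧ M.eRk X ≤ ((q + 1 : ℕ) : ℕ∞)} ⊆
      {X : Set α | X ⊆ M.E ∧ M.eRk X ≤ (q : ℕ∞)} ∪ {X : Set α | X ⊆ M.E ∧ M.eRk X = ((q + 1 : ℕ) : ℕ∞)} := by
    intro X hX
    rcases eq_or_ne (M.eRk X) ((q + 1 : ℕ) : ℕ∞) with h | h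
    · exact Or.inr ⟨hX.1, h⟩
    · left
      refine ⟨hX.1, ?_⟩
      have hlt : M.eRk X < ((q + 1 : ℕ) : ℕ∞) := lt_of_le_of_ne hX.2 h
      rw [Nat.cast_succ, ENat.lt_add_one_iff (by simp)] at hlt
      exact hlt
  have hfin1 : {X : Set α | X ⊆ M.E ∧ M.eRk X ≤ (q : ℕ∞)}.Finite :=
    M.ground_finite.finite_subsets.subset (fun X hX => hX.1)
  have hfin2 : {X : Set α | X ⊆ M.E ∧ M.eRk X = ((q + 1 : ℕ) : ℕ∞)}.Finite :=
    M.ground_finite.finite_subsets.subset (fun X hX => hX.1)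
  calc _ ≤ ({X : Set α | X ⊆ M.E ∧ M.eRk X ≤ (q : ℕ∞)} ∪
        {X : Set α | X ⊆ M.E ∧ M.eRk X = ((q + 1 : ℕ) : ℕ∞)}).ncard := ncard_le_ncard hsub (hfin1.union hfin2)
    _ ≤ _ := ncard_union_le _ _

/-- **THE LEVEL-BY-LEVEL TAIL**: in the `e`-free core of nullity `d` with `s₃ ≤ c3`, `s₄ ≤ c4`,
`#{r ≤ 5} ≤ Σ_{j ≤ 3} C(n, j) + U₃ + U₄ + U₅`, where `U_q = C(n, q) + (σ_q + σ_q′)·P_q(n)` is the heavy / light count at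
level `q` with `ν₁ = 4, 7, 15` (no heavy sets: `f(3) ≤ 6`, `f(4) ≤ 10`, `f(5) ≤ 19`), the size caps `min 6 (3 + d)`,
`min 10 (4 + d)`, `min 19 (5 + d)`, the small class `f′ = 3, min 6 (3 + d), min 10 (4 + d)`, and the disjoint pair counts
`P₃ = c3·C(n − 3, 1) + c4·C(n − 4, 0)`, `P₄ = c3·C(n − 3, 2) + c4·C(n − 4, 1) + C(d + 4, 5)·C(n − 5, 0)`,
`P₅ = c3·C(n − 3, 3) + c4·C(n − 4, 2) + C(d + 4, 5)·C(n − 5, 1) + C(d + 5, 6)·C(n − 6, 0)`. -/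
theorem ncard_eRk_le_five_le_levels (M : Matroid α) [M.Finite] (d c3 c4 : ℕ)
    (hd : M.E.encard = M.eRank + d)
    (hfree : ∀ e ∈ M.E, ∃ A ⊆ M.E \ {e}, e ∉ M.closure A ∧ e ∉ M.closure ((M.E \ {e}) \ A))
    (hs3 : {C | M.IsCircuit C ∧ C.ncard = 3}.ncard ≤ c3) (hs4 : {C | M.IsCircuit C ∧ C.ncard = 4}.ncard ≤ c4) :
    ({X : Set α | X ⊆ M.E ∧ M.eRk X ≤ 5}.ncard : ℚ) ≤
      (∑ j ∈ Finset.range (3 + 1), ((M.E.ncard.choose j : ℕ) : ℚ)) +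
      ((M.E.ncard.choose 3 : ℚ) +
        ((∑ j ∈ Finset.range (min 6 (3 + d) - (3 + 1) + 1),
            ((min (3 - 3) (4 - 2)).choose j : ℚ) * (2 / ((Matroid.mult15 (j + 1) : ℕ) : ℚ))) +
          (∑ j ∈ Finset.range (min 6 (3 + d) - (3 + 1) + 1),
            ((4 - 2).choose j : ℚ) * (2 / ((Matroid.mult15 (j + 1) : ℕ) : ℚ)))) *
        ((c3 : ℚ) * (((M.E.ncard - 3).choose 1 : ℕ) : ℚ) + (c4 : ℚ) * (((M.E.ncard - 4).choose 0 : ℕ) : ℚ))) +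
      ((M.E.ncard.choose 4 : ℚ) +
        ((∑ j ∈ Finset.range (min 10 (4 + d) - (4 + 1) + 1),
            ((min (min 6 (3 + d) - 4) (7 - 2)).choose j : ℚ) * (2 / ((Matroid.mult15 (j + 1) : ℕ) : ℚ))) +
          (∑ j ∈ Finset.range (min 10 (4 + d) - (4 + 1) + 1),
            ((7 - 2).choose j : ℚ) * (2 / ((Matroid.mult15 (j + 1) : ℕ) : ℚ)))) *
        ((c3 : ℚ) * (((M.E.ncard - 3).choose 2 : ℕ) : ℚ) + (c4 : ℚ) * (((M.E.ncard - 4).choose 1 : ℕ) : ℚ) +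
          (((d + 4).choose 5 : ℕ) : ℚ) * (((M.E.ncard - 5).choose 0 : ℕ) : ℚ))) +
      ((M.E.ncard.choose 5 : ℚ) +
        ((∑ j ∈ Finset.range (min 19 (5 + d) - (5 + 1) + 1),
            ((min (min 10 (4 + d) - 5) (15 - 2)).choose j : ℚ) * (2 / ((Matroid.mult15 (j + 1) : ℕ) : ℚ))) +
          (∑ j ∈ Finset.range (min 19 (5 + d) - (5 + 1) + 1),
            ((15 - 2).choose j : ℚ) * (2 / ((Matroid.mult15 (j + 1) : ℕ) : ℚ)))) *
        ((c3 : ℚ) * (((M.E.ncard - 3).choose 3 : ℕ) : ℚ) + (c4 : ℚ) * (((M.E.ncard - 4).choose 2 : ℕ) : ℚ) +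
          (((d + 4).choose 5 : ℕ) : ℚ) * (((M.E.ncard - 5).choose 1 : ℕ) : ℚ) +
          (((d + 5).choose 6 : ℕ) : ℚ) * (((M.E.ncard - 6).choose 0 : ℕ) : ℚ))) := by
  classical
  -- the core is simple, every circuit has `≥ 3` elements, every line `≤ 3` points
  have hL : ∀ e ∈ M.E, ¬ M.IsLoop e := not_isLoop_of_free M hfree
  have hs : ∀ e ∈ M.E, ∀ f ∈ M.E, e ≠ f → M.eRk {e, f} = 2 := by
    intro e he f hf hef
    have h2 : (2 : ℕ∞) ≤ M.eRk {e, f} :=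
      two_le_eRk_of_two_le_ncard_of_free M hfree (pair_subset he hf) (by rw [ncard_pair hef])
    have h3 : M.eRk {e, f} ≤ 2 := by
      have := M.eRk_le_encard {e, f}
      rwa [encard_pair hef] at this
    exact le_antisymm h3 h2
  have hcirc : ∀ C, M.IsCircuit C → 3 ≤ C.encard := three_le_encard_of_circuit M hL hs
  have hC1 : ∀ L ⊆ M.E, M.eRk L = 2 → L.ncard ≤ 3 :=
    fun L hL' hr => ncard_le_three_of_eRk_two M hs hfree hL' hr
  have hC1' : ∀ L ⊆ M.E, M.eRk L ≤ 2 → L.ncard ≤ 3 := by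
    intro L hL' hr
    have := ncard_add_one_le_two_pow_of_eRk_le M hL hfree 2 L hL' hr
    omega
  -- the nullity cap
  have hcap : ∀ X ⊆ M.E, ∀ k : ℕ, M.eRk X ≤ k → X.ncard ≤ k + d := by
    intro X hX k hr
    have h1 := Matroid.encard_le_eRk_add_of_encard_eq hX hd
    have h2 : X.encard ≤ (k : ℕ∞) + d := h1.trans (by gcongr)
    have hfin : X.Finite := M.ground_finite.subset hX
    rw [← hfin.cast_ncard_eq] at h2
    exact_mod_cast h2
  -- the size caps of the three levels
  have hcap3 : ∀ X ⊆ M.E, M.eRk X ≤ ((3 : ℕ) : ℕ∞) → X.ncard ≤ min 6 (3 + d) := fun X hX hr =>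
    le_min (ncard_le_six_of_eRk_le_three_of_free M hfree hX (by simpa using hr)) (hcap X hX 3 (by simpa using hr))
  have hcap4 : ∀ X ⊆ M.E, M.eRk X ≤ ((4 : ℕ) : ℕ∞) → X.ncard ≤ min 10 (4 + d) := fun X hX hr =>
    le_min (ncard_le_ten_of_eRk_le_four_of_free M hfree hX (by simpa using hr)) (hcap X hX 4 (by simpa using hr))
  have hcap5 : ∀ X ⊆ M.E, M.eRk X ≤ ((5 : ℕ) : ℕ∞) → X.ncard ≤ min 19 (5 + d) := fun X hX hr =>
    le_min (ncard_le_nineteen_of_eRk_le_five_of_free M hfree hX (by simpa using hr)) (hcap X hX 5 (by simpa using hr))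
  -- the circuit bounds
  have hs5 : {C | M.IsCircuit C ∧ C.ncard = 5}.ncard ≤ (d + 4).choose 5 :=
    Matroid.ncard_circuits_le_choose_of_encard M hd 4
  have hs6 : {C | M.IsCircuit C ∧ C.ncard = 6}.ncard ≤ (d + 5).choose 6 :=
    Matroid.ncard_circuits_le_choose_of_encard M hd 5
  have hs3q : ({C | M.IsCircuit C ∧ C.ncard = 3}.ncard : ℚ) ≤ (c3 : ℚ) := by exact_mod_cast hs3
  have hs4q : ({C | M.IsCircuit C ∧ C.ncard = 4}.ncard : ℚ) ≤ (c4 : ℚ) := by exact_mod_cast hs4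
  have hs5q : ({C | M.IsCircuit C ∧ C.ncard = 5}.ncard : ℚ) ≤ (((d + 4).choose 5 : ℕ) : ℚ) := by exact_mod_cast hs5
  have hs6q : ({C | M.IsCircuit C ∧ C.ncard = 6}.ncard : ℚ) ≤ (((d + 5).choose 6 : ℕ) : ℚ) := by exact_mod_cast hs6
  -- the three levels
  have hU3 := ncard_eRk_eq_le_level M 3 3 4 (min 6 (3 + d)) (by norm_num) hcirc hC1 hcap3 (by omega)
  have hU4 := ncard_eRk_eq_le_level M 4 (min 6 (3 + d)) 7 (min 10 (4 + d)) (by norm_num) hcirc hC1 hcap4 (by omega)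
  have hU5 := ncard_eRk_eq_le_level M 5 (min 10 (4 + d)) 15 (min 19 (5 + d)) (by norm_num) hcirc hC1 hcap5
    (by omega)
  rw [sum_Icc_three_four_q_levels] at hU3
  rw [sum_Icc_three_five_q_levels] at hU4
  rw [sum_Icc_three_six_q_levels] at hU5
  simp only [show (3 : ℕ) + 1 = 4 from rfl, show (4 : ℕ) + 1 = 5 from rfl, show (5 : ℕ) + 1 = 6 from rfl,
    show (4 : ℕ) - 3 = 1 from rfl, show (4 : ℕ) - 4 = 0 from rfl, show (5 : ℕ) - 3 = 2 from rfl,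
    show (6 : ℕ) - 3 = 3 from rfl, Nat.cast_ofNat] at hU3 hU4 hU5
  -- the rank-`≤ 2` sets have at most `3` elements
  have hA2 : ({X : Set α | X ⊆ M.E ∧ M.eRk X ≤ ((2 : ℕ) : ℕ∞)}.ncard : ℚ) ≤
      ∑ j ∈ Finset.range (3 + 1), ((M.E.ncard.choose j : ℕ) : ℚ) := by
    have h1 : {X : Set α | X ⊆ M.E ∧ M.eRk X ≤ ((2 : ℕ) : ℕ∞)}.ncard ≤
        ∑ j ∈ Finset.range (3 + 1), M.ground_finite.toFinset.card.choose j := by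
      calc {X : Set α | X ⊆ M.E ∧ M.eRk X ≤ ((2 : ℕ) : ℕ∞)}.ncard
          ≤ {X : Set α | X ⊆ (M.ground_finite.toFinset : Set α) ∧ X.ncard ≤ 3}.ncard := by
            apply ncard_le_ncard
            · intro X hX
              exact ⟨by rw [Set.Finite.coe_toFinset]; exact hX.1, hC1' X hX.1 (by simpa using hX.2)⟩
            · exact (Finset.finite_toSet _).finite_subsets.subset (fun X hX => hX.1)
        _ ≤ _ := ncard_subsets_ncard_le _ 3
    rw [← Set.ncard_eq_toFinset_card _ M.ground_finite] at h1
    exact_mod_cast h1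
  -- the level splits
  have hsp5 := ncard_eRk_le_succ_le M 4
  have hsp4 := ncard_eRk_le_succ_le M 3
  have hsp3 := ncard_eRk_le_succ_le M 2
  simp only [show (4 : ℕ) + 1 = 5 from rfl, show (3 : ℕ) + 1 = 4 from rfl, show (2 : ℕ) + 1 = 3 from rfl,
    Nat.cast_ofNat] at hsp5 hsp4 hsp3 hU3 hU4 hU5 hA2
  have hsp5q : ({X : Set α | X ⊆ M.E ∧ M.eRk X ≤ 5}.ncard : ℚ) ≤
      ({X : Set α | X ⊆ M.E ∧ M.eRk X ≤ 4}.ncard : ℚ) + ({X : Set α | X ⊆ M.E ∧ M.eRk X = 5}.ncard : ℚ) := by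
    exact_mod_cast hsp5
  have hsp4q : ({X : Set α | X ⊆ M.E ∧ M.eRk X ≤ 4}.ncard : ℚ) ≤
      ({X : Set α | X ⊆ M.E ∧ M.eRk X ≤ 3}.ncard : ℚ) + ({X : Set α | X ⊆ M.E ∧ M.eRk X = 4}.ncard : ℚ) := by
    exact_mod_cast hsp4
  have hsp3q : ({X : Set α | X ⊆ M.E ∧ M.eRk X ≤ 3}.ncard : ℚ) ≤
      ({X : Set α | X ⊆ M.E ∧ M.eRk X ≤ 2}.ncard : ℚ) + ({X : Set α | X ⊆ M.E ∧ M.eRk X = 3}.ncard : ℚ) := by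
    exact_mod_cast hsp3
  -- monotonicity of the pair polynomials in the circuit counts
  have hσ3 : (0 : ℚ) ≤ (∑ j ∈ Finset.range (min 6 (3 + d) - 4 + 1),
      ((min (3 - 3) (4 - 2)).choose j : ℚ) * (2 / ((Matroid.mult15 (j + 1) : ℕ) : ℚ))) +
      (∑ j ∈ Finset.range (min 6 (3 + d) - 4 + 1), ((4 - 2).choose j : ℚ) * (2 / ((Matroid.mult15 (j + 1) : ℕ) : ℚ))) :=
    add_nonneg (Finset.sum_nonneg (fun i _ => by positivity)) (Finset.sum_nonneg (fun i _ => by positivity))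
  have hσ4 : (0 : ℚ) ≤ (∑ j ∈ Finset.range (min 10 (4 + d) - 5 + 1),
      ((min (min 6 (3 + d) - 4) (7 - 2)).choose j : ℚ) * (2 / ((Matroid.mult15 (j + 1) : ℕ) : ℚ))) +
      (∑ j ∈ Finset.range (min 10 (4 + d) - 5 + 1), ((7 - 2).choose j : ℚ) * (2 / ((Matroid.mult15 (j + 1) : ℕ) : ℚ))) :=
    add_nonneg (Finset.sum_nonneg (fun i _ => by positivity)) (Finset.sum_nonneg (fun i _ => by positivity))
  have hσ5 : (0 : ℚ) ≤ (∑ j ∈ Finset.range (min 19 (5 + d) - 6 + 1),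
      ((min (min 10 (4 + d) - 5) (15 - 2)).choose j : ℚ) * (2 / ((Matroid.mult15 (j + 1) : ℕ) : ℚ))) +
      (∑ j ∈ Finset.range (min 19 (5 + d) - 6 + 1), ((15 - 2).choose j : ℚ) * (2 / ((Matroid.mult15 (j + 1) : ℕ) : ℚ))) :=
    add_nonneg (Finset.sum_nonneg (fun i _ => by positivity)) (Finset.sum_nonneg (fun i _ => by positivity))
  have hP3 : ({C | M.IsCircuit C ∧ C.ncard = 3}.ncard : ℚ) * (((M.E.ncard - 3).choose 1 : ℕ) : ℚ) +
      ({C | M.IsCircuit C ∧ C.ncard = 4}.ncard : ℚ) * (((M.E.ncard - 4).choose 0 : ℕ) : ℚ) ≤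
      (c3 : ℚ) * (((M.E.ncard - 3).choose 1 : ℕ) : ℚ) + (c4 : ℚ) * (((M.E.ncard - 4).choose 0 : ℕ) : ℚ) := by
    gcongr
  have hP4 : ({C | M.IsCircuit C ∧ C.ncard = 3}.ncard : ℚ) * (((M.E.ncard - 3).choose 2 : ℕ) : ℚ) +
      ({C | M.IsCircuit C ∧ C.ncard = 4}.ncard : ℚ) * (((M.E.ncard - 4).choose 1 : ℕ) : ℚ) +
      ({C | M.IsCircuit C ∧ C.ncard = 5}.ncard : ℚ) * (((M.E.ncard - 5).choose 0 : ℕ) : ℚ) ≤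
      (c3 : ℚ) * (((M.E.ncard - 3).choose 2 : ℕ) : ℚ) + (c4 : ℚ) * (((M.E.ncard - 4).choose 1 : ℕ) : ℚ) +
        (((d + 4).choose 5 : ℕ) : ℚ) * (((M.E.ncard - 5).choose 0 : ℕ) : ℚ) := by
    gcongr
  have hP5 : ({C | M.IsCircuit C ∧ C.ncard = 3}.ncard : ℚ) * (((M.E.ncard - 3).choose 3 : ℕ) : ℚ) +
      ({C | M.IsCircuit C ∧ C.ncard = 4}.ncard : ℚ) * (((M.E.ncard - 4).choose 2 : ℕ) : ℚ) +
      ({C | M.IsCircuit C ∧ C.ncard = 5}.ncard : ℚ) * (((M.E.ncard - 5).choose 1 : ℕ) : ℚ) +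
      ({C | M.IsCircuit C ∧ C.ncard = 6}.ncard : ℚ) * (((M.E.ncard - 6).choose 0 : ℕ) : ℚ) ≤
      (c3 : ℚ) * (((M.E.ncard - 3).choose 3 : ℕ) : ℚ) + (c4 : ℚ) * (((M.E.ncard - 4).choose 2 : ℕ) : ℚ) +
        (((d + 4).choose 5 : ℕ) : ℚ) * (((M.E.ncard - 5).choose 1 : ℕ) : ℚ) +
        (((d + 5).choose 6 : ℕ) : ℚ) * (((M.E.ncard - 6).choose 0 : ℕ) : ℚ) := by
    gcongr
  have e3 := mul_le_mul_of_nonneg_left hP3 hσ3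
  have e4 := mul_le_mul_of_nonneg_left hP4 hσ4
  have e5 := mul_le_mul_of_nonneg_left hP5 hσ5
  linarith [hsp5q, hsp4q, hsp3q, hA2, hU3, hU4, hU5, e3, e4, e5]

end ThmN

end PercRepro
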